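import Mathlib.GroupTheory.Solvable
import Mathlib.LinearAlgebra.BilinearForm.Orthogonal
import Mathlib.LinearAlgebra.Matrix.BilinearForm
import Mathlib.RepresentationTheory.Irreducible
import Literature.NumberTheory.GaloisRepresentations.ContinuousRep
import HarnessLib

/-!
# The dual of a framed representation: image, solvability, irreducibility
(pure proofs; companion to `Literature.NumberTheory.GaloisRepresentations.ContinuousRep` and
`FramedRepDualProofs`)

For a framed representation `ρ : G →ₜ* GL_n(A)` the dual (contragredient) representation is
`ρ^∨ = (·ᵀ)⁻¹ ∘ ρ` (`FramedRep.dual`, Serre, *Linear representations of finite groups*, §1.4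
(d)).  This file records the elementary facts needed to feed `ρ^∨` into statements
quantifying over irreducible representations with solvable image (the Langlands–Tunnell
assembly `Automorphic/LanglandsTunnellArtinFE`):

* `FramedRep.toMonoidHom_dual`, `FramedRep.range_toMonoidHom_dual` — the image of `ρ^∨` is
  the image of `ρ` under the automorphism `g ↦ (gᵀ)⁻¹` of `GL_n(A)`;
* `FramedRep.isSolvable_range_dual` — hence solvable when the image of `ρ` is;
* `FramedRep.IsAbsolutelyIrreducible.dual` (appended) — `ρ` absolutely irreducible ⇒ `ρ^∨` absolutely
  irreducible (`dual_baseChange` + `isIrreducible_dual` after every base change to a field), and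
  `FramedRep.trace_dual` — `tr ρ^∨(g) = tr ρ(g⁻¹)`; used for the `λ`-adic representation of a Picard
  curve (`PicardCurveGaloisRep`), which is the dual of a Tate-module representation;
* `FramedRep.isIrreducible_dual` — over a field, `ρ` irreducible ⇒ `ρ^∨` irreducible
  (Mathlib `Representation.IsIrreducible` = the lattice of subrepresentations is simple).
  Proof: the standard pairing `⟨v, w⟩ = v ⬝ᵥ w` on `Aⁿ` is non-degenerate, symmetric and
  `G`-invariant for `(ρ, ρ^∨)`, i.e. `⟨ρ(g) v, ρ^∨(g) w⟩ = ⟨v, w⟩`; so the orthogonal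
  `W^⊥` of a `ρ^∨`-stable subspace `W` is `ρ`-stable, `W ↦ W^⊥` is injective
  (`W^⊥⊥ = W`, Mathlib `LinearMap.BilinForm.orthogonal_orthogonal`), and `W^⊥ ∈ {0, Aⁿ}`
  forces `W ∈ {Aⁿ, 0}` (Serre §1.4 (d); Curtis–Reiner (10.27)).

Nothing here restates an existing declaration (`lean search "dual"` in
`GaloisRepresentations/`, `RepresentationTheory/`: only `finite_range_dual`, `charpoly_dual…`,
`isUnramifiedAt_dual`, `hasFrobCharpolyAt_dual`, `isOdd_dual`, `artinConductorNat_dual`).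

## References

* J.-P. Serre, *Linear Representations of Finite Groups*, GTM 42 (1977), §1.4 (d)
  (contragredient representation; invariant bilinear pairing). [SerreLinearRepresentations1977]
-/

noncomputable section

open Matrix

namespace Literature.NumberTheory.GaloisRepresentations

namespace FramedRep

variable {G : Type*} [Group G] [TopologicalSpace G] {n : ℕ}

section Image

variable {A : Type*} [CommRing A] [TopologicalSpace A]

/-- The group homomorphism underlying `ρ^∨` is `(·ᵀ)⁻¹ ∘ ρ` (definitional). [folklore] -/
theorem toMonoidHom_dual (ρ : FramedRep G A n) :
    (FramedRep.dual ρ).toMonoidHom = (glTransposeInv (Fin n) A).toMonoidHom.comp ρ.toMonoidHom :=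
  rfl

/-- The image of `ρ^∨` is the image of the image of `ρ` under `g ↦ (gᵀ)⁻¹`
(Mathlib `MonoidHom.range_comp`). [folklore] -/
theorem range_toMonoidHom_dual (ρ : FramedRep G A n) :
    (FramedRep.dual ρ).toMonoidHom.range =
      ρ.toMonoidHom.range.map (glTransposeInv (Fin n) A).toMonoidHom := by
  rw [toMonoidHom_dual, MonoidHom.range_comp]

/-- **The dual of a representation with solvable image has solvable image**: the image of
`ρ^∨` is a homomorphic image of the image of `ρ` (`MonoidHom.subgroupMap_surjective`,
`solvable_of_surjective`). [folklore] -/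
theorem isSolvable_range_dual (ρ : FramedRep G A n) (h : IsSolvable ρ.toMonoidHom.range) :
    IsSolvable (FramedRep.dual ρ).toMonoidHom.range := by
  rw [range_toMonoidHom_dual]
  exact solvable_of_surjective
    (MonoidHom.subgroupMap_surjective (glTransposeInv (Fin n) A).toMonoidHom ρ.toMonoidHom.range)

/-- `ρ^∨(g⁻¹)` is the transpose of `ρ(g)` (as matrices): `((ρ g⁻¹)⁻¹)ᵀ = (ρ g)ᵀ`. [folklore] -/
theorem coe_dual_apply_inv (ρ : FramedRep G A n) (g : G) :
    ((FramedRep.dual ρ g⁻¹ : GL (Fin n) A) : Matrix (Fin n) (Fin n) A) =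
      ((ρ g : GL (Fin n) A) : Matrix (Fin n) (Fin n) A)ᵀ := by
  rw [coe_dual_apply, map_inv, inv_inv]

end Image

section Irreducible

variable {k : Type*} [Field k] [TopologicalSpace k]

/-- **The standard pairing is invariant for `(ρ, ρ^∨)`** in the form used below: for a
`ρ^∨`-stable subspace `W ≤ kⁿ`, its orthogonal `{v | ∀ w ∈ W, w ⬝ᵥ v = 0}` for the dot product
(`Matrix.toBilin' 1`) is `ρ`-stable, since `w ⬝ᵥ (ρ(g) v) = ((ρ g)ᵀ w) ⬝ᵥ v = (ρ^∨(g⁻¹) w) ⬝ᵥ v`.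
Ref: Serre, *Linear representations of finite groups*, §1.4 (d). [folklore] -/
theorem apply_mem_orthogonal_of_dual_stable (ρ : FramedRep G k n)
    (W : Subrepresentation (FramedRep.dual ρ).toRepresentation) (g : G) {v : Fin n → k}
    (hv : v ∈ (Matrix.toBilin' (1 : Matrix (Fin n) (Fin n) k)).orthogonal W.toSubmodule) :
    ρ.toRepresentation g v ∈
      (Matrix.toBilin' (1 : Matrix (Fin n) (Fin n) k)).orthogonal W.toSubmodule := by
  rw [LinearMap.BilinForm.mem_orthogonal_iff] at hv ⊢
  intro w hw
  have hw' : (FramedRep.dual ρ).toRepresentation g⁻¹ w ∈ W.toSubmodule :=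
    W.apply_mem_toSubmodule g⁻¹ hw
  have h0 := hv _ hw'
  rw [Matrix.toBilin'_apply', Matrix.one_mulVec] at h0 ⊢
  rw [toRepresentation_apply_apply, dotProduct_mulVec, ← mulVec_transpose,
    ← coe_dual_apply_inv]
  exact h0

/-- **The dual of an irreducible representation is irreducible** (over a field; Mathlib
`Representation.IsIrreducible ρ` = `IsSimpleOrder (Subrepresentation ρ)`).  If `W` is a
`ρ^∨`-stable subspace then `W^⊥` is `ρ`-stable (`apply_mem_orthogonal_of_dual_stable`), hence
`W^⊥ = 0` or
`W^⊥ = kⁿ`, and `W = W^⊥⊥` (`LinearMap.BilinForm.orthogonal_orthogonal`: the dot product is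
non-degenerate — `det 1 ≠ 0` — and symmetric) is accordingly `kⁿ` or `0`.
The subspace argument avoids characters (for finite `G` over `ℂ` one could instead use
`χ_{ρ^∨} = \bar χ_ρ`, Serre §2.1, Prop. 1).
[cite: SerreLinearRepresentations1977, §1.4 (d)] -/
theorem isIrreducible_dual (ρ : FramedRep G k n) (h : ρ.IsIrreducible) :
    (FramedRep.dual ρ).IsIrreducible := by
  set B : LinearMap.BilinForm k (Fin n → k) := Matrix.toBilin' (1 : Matrix (Fin n) (Fin n) k)
    with hB
  have hBnd : B.Nondegenerate :=
    LinearMap.BilinForm.nondegenerate_toBilin'_of_det_ne_zero' _ (by rw [det_one]; exact one_ne_zero)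
  have hBsymm : B.IsSymm := Matrix.isSymm_toBilin'_iff_isSymm.2 isSymm_one
  have hBrefl : B.IsRefl := hBsymm.isRefl
  haveI : IsSimpleOrder (Subrepresentation ρ.toRepresentation) := h
  -- the ambient space is non-trivial, since `ρ` has two distinct subrepresentations
  have hbt : (⊥ : Submodule k (Fin n → k)) ≠ ⊤ := by
    intro hbt
    have h01 : (⊥ : Subrepresentation ρ.toRepresentation) ≠ ⊤ := bot_ne_top
    exact h01 (Subrepresentation.toSubmodule_injective hbt)
  refine { toNontrivial := ⟨⟨⊥, ⊤, fun hbt' => hbt (congrArg Subrepresentation.toSubmodule hbt')⟩⟩,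
           eq_bot_or_eq_top := fun W => ?_ }
  have hWW : B.orthogonal (B.orthogonal W.toSubmodule) = W.toSubmodule :=
    LinearMap.BilinForm.orthogonal_orthogonal hBnd hBrefl _
  -- the `ρ`-subrepresentation `W^⊥`
  let W' : Subrepresentation ρ.toRepresentation :=
    ⟨B.orthogonal W.toSubmodule, fun g _ hv => ρ.apply_mem_orthogonal_of_dual_stable W g hv⟩
  rcases eq_bot_or_eq_top W' with h0 | h1
  · -- `W^⊥ = 0`, so `W = 0^⊥ = kⁿ`
    right
    apply Subrepresentation.toSubmodule_injective
    have h0' : B.orthogonal W.toSubmodule = ⊥ := congrArg Subrepresentation.toSubmodule h0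
    rw [← hWW, h0', LinearMap.BilinForm.orthogonal_bot]
    rfl
  · -- `W^⊥ = kⁿ`, so `W = (kⁿ)^⊥ = 0`
    left
    apply Subrepresentation.toSubmodule_injective
    have h1' : B.orthogonal W.toSubmodule = ⊤ := congrArg Subrepresentation.toSubmodule h1
    rw [← hWW, h1', LinearMap.BilinForm.orthogonal_top_eq_bot hBnd]
    rfl

/-- `isIrreducible_dual` for the continuous representation on `kⁿ` underlying a framed
representation over a topological field (`FramedRep.toContinuousRep`, the form in which
irreducibility is consumed by `ArtinRep`/`GaloisRep` statements). [folklore] -/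
theorem isIrreducible_toContinuousRep_dual [IsTopologicalRing k] (ρ : FramedRep G k n)
    (h : ρ.toContinuousRep.IsIrreducible) : (FramedRep.dual ρ).toContinuousRep.IsIrreducible :=
  (isIrreducible_toContinuousRep_iff _).2 (ρ.isIrreducible_dual ((isIrreducible_toContinuousRep_iff _).1 h))

end Irreducible

/-! ### Absolute irreducibility and trace of the dual -/

section AbsolutelyIrreducible

variable {A : Type*} [CommRing A] [TopologicalSpace A]

/-- `tr ρ^∨(g) = tr ρ(g⁻¹)`. [folklore] -/
theorem trace_dual (ρ : FramedRep G A n) (g : G) : FramedRep.trace (FramedRep.dual ρ) g = FramedRep.trace ρ g⁻¹ := by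
  rw [FramedRep.trace, FramedRep.trace, coe_dual_apply, Matrix.trace_transpose, map_inv]

/-- Base change commutes with the dual: `(ρ ⊗_f B)^∨ = ρ^∨ ⊗_f B`. [folklore] -/
theorem dual_baseChange {B : Type*} [CommRing B] [TopologicalSpace B] (f : A →+* B) (hf : Continuous f)
    (ρ : FramedRep G A n) : FramedRep.dual (ρ.baseChange f hf) = (FramedRep.dual ρ).baseChange f hf := by
  refine ContinuousMonoidHom.ext fun g => Units.ext ?_
  rw [coe_dual_apply, baseChange_apply, baseChange_apply, ← map_inv]
  change (f.mapMatrix (((ρ g)⁻¹ : GL (Fin n) A) : Matrix (Fin n) (Fin n) A))ᵀ =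
    f.mapMatrix ((FramedRep.dual ρ g : GL (Fin n) A) : Matrix (Fin n) (Fin n) A)
  rw [coe_dual_apply, RingHom.mapMatrix_apply, RingHom.mapMatrix_apply, Matrix.transpose_map]

/-- **The dual of an absolutely irreducible framed representation is absolutely irreducible**: after
any base change `f : k →+* B` to a field, `(ρ ⊗ B)^∨ = ρ^∨ ⊗ B` (`dual_baseChange`, `B` given the
indiscrete topology so that `f` is continuous) and `isIrreducible_dual` applies over `B`.
[cite: SerreLinearRepresentations1977, §1.4 (d)] -/
theorem IsAbsolutelyIrreducible.dual {k : Type*} [Field k] [TopologicalSpace k] {ρ : FramedRep G k n}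
    (h : ρ.IsAbsolutelyIrreducible) : (FramedRep.dual ρ).IsAbsolutelyIrreducible := by
  intro B _ f
  letI : TopologicalSpace B := ⊤
  have hf : Continuous f := continuous_top
  have h2 := isIrreducible_dual (ρ.baseChange f hf) (h B f)
  rw [dual_baseChange] at h2
  exact h2

end AbsolutelyIrreducible

end FramedRep

end Literature.NumberTheory.GaloisRepresentations

end
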